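/-
Copyright (c) 2026 the pub-hodgecm-mathlib formalisation cell (harness21).  Prover seat hodgecm-mathlib-LH4-p06 (g10), req620 Track A «(D-RAM) FOUR-FRAME» squad
F0∕P3c∕LH4; the (β₂) road (R-36), the MIX-HI WALL (β₂ WORDs #34∕#36; lead LH4-p13 (g10)): «THE PRODUCT BALANCE FROM THE FIBRES — DIAGONAL TWIN» — the LATTICE HALF of the
‹PRODBAL-D› payer, hypothesis-first; helper lane on h413 = stmt-HodgeConjecture-24833 (count-neutral).  2026-09-05.
-/
import Summits.HodgeConjecture.HodgeConjecture.Theorems.F0P3cDyRamMixBandProdBalanceOfFibres          -- ★ (this seat): §1 `ncard_sep_eq_ncard_sep_of_digit_reads`, §2 one-field lemmas, the U twin `prodBalanceU_of_fibres`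
import Summits.HodgeConjecture.HodgeConjecture.Theorems.F0P3cDyRamBeta2ConesOffRowDiagMixOfProdBalance  -- ★ p864725 (LH4-p13 (g10)): the CONSUMER `offRowDmix_of_prodBalance (hbal : ‹PRODBAL-D›)`
import HarnessLib

/-!
# Crux `H413`, line LH4 «(D-RAM) FOUR-FRAME» — STAGE-1b, row (2) of `f_{T₊}`, the (β₂) road (R-36), the MIX-HI WALL: «THE PRODUCT BALANCE FROM THE FIBRES — DIAGONAL TWIN» — on the
# diagonal MIX cell `(b, b)` (`jl = m`), ‹PRODBAL-D› 8687a6b9's conclusion `#{Λ ∈ cell ∣ NX Λ ∧ Pc Λ} = #{Λ ∈ cell ∣ NX Λ ∧ ¬ Pc Λ}` VERBATIM, FROM the digit letters (hypothesis-first)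

Cell `hodgecm-mathlib` (D-0151), FLOOR 0, crux item H413 = `stmt-HodgeConjecture-24833`, route of record `HCCMUnconditional`; squads F0∕P3c∕LH4 ∕ LH7; lane
`--supports stmt-HodgeConjecture-24833 --as helper` (count-neutral; pays NO tier-0 row).  THEOREMS ONLY (no `def`, no instance, no notation, no `sorry`, default heartbeats);
★-only imports; states NO law; ‹PRODBAL-D›, the MIX-HI band letters and (β₂) `stub_law_cleanSgn₂` stay HYPOTHESES of their consumers.
WHAT.  ‹PRODBAL-D› = binder `hbal` of ★ p864725 `offRowDmix_of_prodBalance` = ‹PRODBAL-U› with the upper-line cell line replaced by the DIAGONAL MIX cell line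
`1 ≤ b → j = b → m < 2b → jl = m → m_c + 2b ≤ 2m → m < m⋆ + b → IsOrd(lam)` (the two letters agree byte for byte elsewhere: same block, same `NX` ∕ `Pc` bodies = ★ p864672's
`hNX` ∕ `hPc` right-hand sides).  The lattice-half count of ★ `…MixBandProdBalanceOfFibres` never touches the cell line, so THIS FILE is its diagonal twin with the SAME letters:
* HEAD `prodBalanceD_of_fibres (N)` — ‹PRODBAL-D›'s block and diagonal MIX cell line VERBATIM, THEN the lattice-half letters as named binders, in the U twin's order and bytes — digit
  `(Vf, n, Rd)` + class-system letters `hRd1 hRd2 hRd3` modulo `|ϖ|^n`; `LIT`; `hgen` (generator independence at `|ϖ|^n`); `hV`; `hLit`; `hF` (★ p864078's shape, class-free);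
  affine letters `α₁ γ₁ ℓ s₀`, `σα₁ = α₁`, `σγ₁ = γ₁`; (LH-3) `hrad : |γ₁|·|ϖ|^n ≤ |ϖ|^{2ℓ}·|ϖ|^{2d−1}`; the reads `hNXd`, `hPcd` (★ p864917 modulo the affine substitution); `hbase`
  (★ R0 p864098's bytes) — THEN ‹PRODBAL-D›'s `ncard` equality VERBATIM.  Proof = the U twin's: ★ §1 at `GEN :=` the six membership clauses of `levelSetDep`, `ND :=` the value
  sphere, `PD :=` the affine sign, digit constancy by ★ §2 from `hrad`.  Assembler shape (MIX-HI lead): `offRowDmix_holds N hN := ★ offRowDmix_of_prodBalance N hN (fun E M … j b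
  h₁ … h₇ => prodBalanceD_of_fibres N E M … j b h₁ … h₇ Vf n Rd hRd1 hRd2 hRd3 LIT hgen hV hLit hF α₁ γ₁ ℓ s₀ hσα₁ hσγ₁ hrad hNXd hPcd hbase)`.
WHAT IS NOT CLAIMED: any binder — the digit payer's ∕ ★ p864917's ∕ (LH-3)'s; ‹PRODBAL-D› stays the binder of ★ p864725 until the assembler supplies them BY NAME.
HONEST LABEL.  Count-neutral bookkeeping; nothing printed is asserted; no census law is stated; ‹PRODBAL-U∕D›, `core_holds`, (β₂) `stub_law_cleanSgn₂` UNPROVED; `HC_CM` is proved only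
modulo the 7 printed citations (2 remaining named inputs: hLiu418 = `stmt-HodgeConjecture-24832`, h413 = `stmt-HodgeConjecture-24833`) until rung 0 closes.
## References
* [Kottwitz1986BaseChangeUnits] R. E. Kottwitz, *Base change for unit elements of Hecke algebras*, Compositio Math. 60 (1986): §1 pp. 240–241 (cell-by-cell fixed-lattice counts).
* [LabesseLanglands1979] J.-P. Labesse, R. P. Langlands, *L-indistinguishability for SL(2)*, Canad. J. Math. 31 (1979): §2 (2.2) p. 9 (κ-signed counts).
* [Rogawski1990] J. D. Rogawski, *Automorphic Representations of Unitary Groups in Three Variables*, Ann. of Math. Stud. 123 (1990): §4.9 Prop. 4.9.1 (b) p. 55.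
* [Serre1979] J.-P. Serre, *Local Fields*, GTM 67 (1979): Ch. V §3 Cor. 3 pp. 84–86; Ch. XV §2 (the conductor).
-/

set_option autoImplicit false

noncomputable section

namespace Summit.HodgeConjecture.HodgeConjecture.Cruxes.H413.F0P3cDyRamMixBandProdBalanceOfFibresDiag

open scoped Valued WithZero Matrix MatrixGroups Pointwise Classical
open WithZero Finset
open Literature.NumberTheory.Automorphic Literature.NumberTheory.Automorphic.HermitianLattice Literature.NumberTheory.Automorphic.UnitaryLatticeTree
open Literature.NumberTheory.Automorphic.UnitaryThreeFourFrame (IsRamifiedQuadraticDatum normSign)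
open Literature.NumberTheory.Rogawski1990
open Summit.HodgeConjecture.HodgeConjecture.Cruxes.H413.F0P3cDyRamFourFramePieces
open Summit.HodgeConjecture.HodgeConjecture.Cruxes.H413.F0P3cDyRamFourFrameCensusDefs (LatticeInLevel LatticeNearTransvShell)
open Summit.HodgeConjecture.HodgeConjecture.Cruxes.H413.F0P3cDyRamStageOneBDefs (mcOfRecord)
open Summit.HodgeConjecture.HodgeConjecture.Cruxes.H413.F0P3cDyRamToricCensusDefs
open Summit.HodgeConjecture.HodgeConjecture.Cruxes.H413.F0P3cDyRamMixBandProdBalanceOfFibres (ncard_sep_eq_ncard_sep_of_digit_reads valueSphere_iff_of_near normSign_affine_eq_of_near)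

variable {E M : Type} [Field E] [Valued E ℤᵐ⁰] [Field M] [Valued M ℤᵐ⁰] {σ : E →+* E}

/-- **HEAD — «THE PRODUCT BALANCE FROM THE FIBRES, DIAGONAL TWIN» (the LATTICE HALF of the ‹PRODBAL-D› payer, hypothesis-first).**  Binders: `N`; ‹PRODBAL-D› 8687a6b9's block (= ★
p864725 `offRowDmix_of_prodBalance`'s `hbal` lines) and its DIAGONAL MIX cell line `1 ≤ b`, `j = b`, `m < 2b`, `jl = m`, `m_c + 2b ≤ 2m`, `m < m⋆ + b`, `IsOrd(lam)` VERBATIM; THEN the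
lattice-half letters exactly as in the U twin ★ `prodBalanceU_of_fibres` (digit `Vf n Rd` + class-system letters, `LIT`, `hgen`, `hV`, `hLit`, `hF`, affine letters `α₁ γ₁ ℓ s₀`, `hrad`,
reads `hNXd` ∕ `hPcd`, `hbase`); THEN ‹PRODBAL-D›'s conclusion VERBATIM.  Proof: the U twin's, by ★ §1 and ★ §2.
[cite: Kottwitz1986BaseChangeUnits, §1 pp. 240–241] [cite: LabesseLanglands1979, §2 (2.2) p. 9] [cite: Rogawski1990, §4.9 Prop. 4.9.1 (b) p. 55] [cite: Serre1979, Ch. XV §2] -/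
theorem prodBalanceD_of_fibres (N : ℕ → ℕ → ℕ → ℕ) :
    ∀ (E M : Type) [Field E] [Valued E ℤᵐ⁰] [CompleteSpace E] [IsDiscreteValuationRing 𝒪[E]] [Finite 𝓀[E]]
      [Field M] [Valued M ℤᵐ⁰] [CompleteSpace M] [IsDiscreteValuationRing 𝒪[M]] [Finite 𝓀[M]]
      (σ : E →+* E) (ϖ : E) (d tE : ℕ) (_hD : IsRamifiedQuadraticDatum σ ϖ d tE) (_hσσ : ∀ a, σ (σ a) = a) (_h2 : ¬ IsUnit (2 : 𝒪[E]))
      (jE : E →+* M) (ρ Θ : M →+* M) (α lam : M)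
      (_hρρ : ∀ z, ρ (ρ z) = z) (_hvρ : ∀ z, Valued.v (ρ z) = Valued.v z) (_hρj : ∀ a, ρ (jE a) = jE a)
      (_hjv : ∀ a, Valued.v (jE a) ≤ 1 ↔ Valued.v a ≤ 1) (_hjfix : ∀ z : M, ρ z = z ↔ ∃ a, jE a = z) (_hΘj : ∀ a, Θ (jE a) = jE (σ a))
      (_hΘΘ : ∀ z, Θ (Θ z) = z) (_hΘρ : ∀ z, Θ (ρ z) = ρ (Θ z)) (_hvΘ : ∀ z, Valued.v (Θ z) = Valued.v z)
      (_hα : ρ α ≠ α) (_hα1 : Valued.v α ≤ 1) (_hint : ∀ z : M, Valued.v z ≤ 1 → Valued.v ((z - ρ z) / (α - ρ α)) ≤ 1)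
      (_hΘlam : Θ lam * lam = 1) (_hvlam : Valued.v lam = 1) (_hbasis : ∀ z : M, ∃! pq : E × E, z = jE pq.1 + jE pq.2 * lam)
      (_hU : Valued.v (α - ρ α) = 1) (_hτ : Valued.v (α - Θ α) < 1)
      (_hσres : ∀ z : M, ρ z = z → Valued.v z ≤ 1 → Valued.v (Θ z - z) < 1) (_hres : ∀ z : M, Valued.v z ≤ 1 → Valued.v (z - Θ z) < 1)
      (_hΘne : ∃ x : M, Θ x ≠ x) (_hDM : IsRamifiedQuadraticDatum Θ (jE ϖ) d tE) (_hjiso : ∀ a, Valued.v (jE a) = Valued.v a)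
      (_hq : Nat.card 𝓀[M] = Nat.card 𝓀[E] ^ 2) (_hjpow : ∀ (t : E) (n : ℤ), Valued.v (jE t) = Valued.v (jE ϖ) ^ n ↔ Valued.v t = Valued.v ϖ ^ n)
      (_hEval : ∀ c : M, ρ c = c → c ≠ 0 → Valued.v c ≤ 1 → ∃ n : ℕ, Valued.v c = Valued.v (jE ϖ) ^ n)
      (_hϖmax : ∀ t : M, ρ t = t → Valued.v t < 1 → Valued.v t ≤ Valued.v (jE ϖ))
      (γ₂ : GL (Fin 2) E) (u : GL (Fin 1) E)
      (_hdet : (γ₂ : Matrix (Fin 2) (Fin 2) E).det * σ (γ₂ : Matrix (Fin 2) (Fin 2) E).det = 1)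
      (_htr : (γ₂ : Matrix (Fin 2) (Fin 2) E).trace = (γ₂ : Matrix (Fin 2) (Fin 2) E).det * σ (γ₂ : Matrix (Fin 2) (Fin 2) E).trace)
      (_hirr : ∀ x : E, x * x - (γ₂ : Matrix (Fin 2) (Fin 2) E).trace * x + (γ₂ : Matrix (Fin 2) (Fin 2) E).det ≠ 0)
      (_hlam2 : lam * lam = jE (γ₂ : Matrix (Fin 2) (Fin 2) E).trace * lam - jE (γ₂ : Matrix (Fin 2) (Fin 2) E).det)
      (_hρlam : ρ lam = jE (γ₂ : Matrix (Fin 2) (Fin 2) E).trace - lam) (m jl : ℕ) (_hm : Valued.v (lam - jE ((u : Matrix (Fin 1) (Fin 1) E) 0 0)) = WithZero.exp (-(m : ℤ)))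
      (_hjl : Valued.v ((lam - jE ((u : Matrix (Fin 1) (Fin 1) E) 0 0)) - ρ (lam - jE ((u : Matrix (Fin 1) (Fin 1) E) 0 0))) = WithZero.exp (-(jl : ℤ)))
      (_hs : Valued.v ((γ₂ : Matrix (Fin 2) (Fin 2) E).trace - 2) * Valued.v (ϖ ^ (d % 2)) ≤ Valued.v (ϖ ^ mcOfRecord d))
      (_hp : Valued.v ((γ₂ : Matrix (Fin 2) (Fin 2) E).det - (γ₂ : Matrix (Fin 2) (Fin 2) E).trace + 1) ≤ Valued.v (ϖ ^ mcOfRecord d))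
      (_hNm : N d tE (Nat.card 𝓀[E]) ≤ m) (_hu1N : Valued.v (((u : Matrix (Fin 1) (Fin 1) E) 0 0) - 1) ≤ Valued.v (ϖ ^ N d tE (Nat.card 𝓀[E]))) (_hlam1 : Valued.v (lam - 1) ≤ Valued.v (jE ϖ ^ N d tE (Nat.card 𝓀[E])))
      (_hu : Valued.v ((u : Matrix (Fin 1) (Fin 1) E) 0 0) = 1) (_hum : Valued.v (((u : Matrix (Fin 1) (Fin 1) E) 0 0) - 1) ≤ Valued.v (ϖ ^ mstarOfRecord d))
      (H₂ : Matrix (Fin 2) (Fin 2) E) (hW : E) (_hH₂ : IsUnit H₂.det) (_hH₂σ : (H₂.map σ)ᵀ = H₂) (_hhW : Valued.v hW = 1) (_hhWσ : σ hW = hW)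
      (P₁ : GL (Fin 3) E) (_hA : formCongr σ P₁ ((StdForm.antidiagonal 3).over E) = (!![H₂ 0 0, 0, H₂ 0 1; 0, hW, 0; H₂ 1 0, 0, H₂ 1 1] : Matrix (Fin 3) (Fin 3) E))
      (_hΓ : P₁ * endoGL (γ₂, u) * P₁⁻¹ ∈ unitaryGroupOfForm σ ((StdForm.antidiagonal 3).over E))
      (φ : (Fin 2 → E) →+ M) (h : M) (_hφs : ∀ (c : E) (x : Fin 2 → E), φ (c • x) = jE c * φ x) (_hφi : Function.Injective φ) (_hφo : Function.Surjective φ)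
      (_hφγ : ∀ x, φ ((γ₂ : Matrix (Fin 2) (Fin 2) E).mulVec x) = lam * φ x)
      (_hform : ∀ x y, jE (pairing σ H₂ x y) = h * Θ (φ x) * φ y + ρ (h * Θ (φ x) * φ y)) (_hΘh : Θ h = h) (_hh : h ≠ 0)
      (J R : ℕ) (f : ℕ → ℕ → AddSubgroup M → ℕ)
      (_hfinF : {L₃ : Submodule 𝒪[E] (Fin 3 → E) | IsSelfDualLattice σ ϖ (!![H₂ 0 0, 0, H₂ 0 1; 0, hW, 0; H₂ 1 0, 0, H₂ 1 1] : Matrix (Fin 3) (Fin 3) E) L₃ ∧ mapGL (endoGL (γ₂, u)) L₃ = L₃}.Finite)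
      (_hR : ∀ L₃ : Submodule 𝒪[E] (Fin 3 → E), IsSelfDualLattice σ ϖ (!![H₂ 0 0, 0, H₂ 0 1; 0, hW, 0; H₂ 1 0, 0, H₂ 1 1] : Matrix (Fin 3) (Fin 3) E) L₃ →
        mapGL (endoGL (γ₂, u)) L₃ = L₃ → ∀ b : ℕ, (∀ c : E, (Pi.single 1 c : Fin 3 → E) ∈ L₃ ↔ Valued.v c ≤ Valued.v ϖ ^ b) → b ≤ R)
      (_hJ : ¬ IsOrd ρ α (jE ϖ ^ (J + 1)) lam) (_hfinLS : ∀ j a, (levelSet ρ Θ α (jE ϖ) h j a).Finite)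
      (_hf : ∀ (b j : ℕ) (Λ : AddSubgroup M) (x₀ : M) (r : E), 1 ≤ b → x₀ ≠ 0 → (∀ x, x ∈ Λ ↔ ∃ z, IsOrd ρ α (jE ϖ ^ j) z ∧ x = x₀ * z) →
        IsOrd ρ α (jE ϖ ^ j) (dualGen ρ Θ α (jE ϖ ^ j) h x₀) → ¬ IsOrd ρ α (jE ϖ ^ j) (dualGen ρ Θ α (jE ϖ ^ j) h x₀ / jE ϖ) → Valued.v (dualGen ρ Θ α (jE ϖ ^ j) h x₀) = Valued.v (jE ϖ) ^ b →
        (∀ b', (∀ x ∈ Λ, Valued.v (h * Θ x * b' + ρ (h * Θ x * b')) ≤ 1) → (lam - jE ((u : Matrix (Fin 1) (Fin 1) E) 0 0)) * b' ∈ Λ) → IsOrd ρ α (jE ϖ ^ j) lam →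
        jE r = glueUnit ρ Θ α (jE ϖ ^ j) h (jE ϖ) (jE hW) x₀ b →
        f b j Λ = Nat.card {x : 𝒪[E] ⧸ 𝓂[E] ^ (2 * b) // ∃ u' : 𝒪[E], Ideal.Quotient.mk (𝓂[E] ^ (2 * b)) u' = x ∧ Valued.v ((u' : E) * σ u' - r) ≤ Valued.v (ϖ ^ (2 * b))}),
      ∀ j b : ℕ, 1 ≤ b → j = b → m < 2 * b → jl = m → mcOfRecord d + 2 * b ≤ 2 * m → m < mstarOfRecord d + b → IsOrd ρ α (jE ϖ ^ j) lam →
              -- ══ the LATTICE-HALF LETTERS (hypothesis-first; MIX-HI DIGIT READING v2 (LH-0)–(LH-4)) ══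
              ∀ (Vf : M → M) (n : ℕ) (Rd : Finset E),
                (∀ V ∈ Rd, σ V = V ∧ Valued.v V ≤ 1) →
                (∀ V : E, σ V = V → Valued.v V ≤ 1 → ∃ V₀ ∈ Rd, Valued.v (V - V₀) ≤ Valued.v ϖ ^ n) →
                (∀ V ∈ Rd, ∀ V' ∈ Rd, Valued.v (V - V') ≤ Valued.v ϖ ^ n → V = V') →
              ∀ (LIT : E → Prop),
                (∀ (Λ : AddSubgroup M) (x₀ x₀' : M),
                  (x₀ ≠ 0 ∧ (∀ x, x ∈ Λ ↔ ∃ ζ, IsOrd ρ α (jE ϖ ^ j) ζ ∧ x = x₀ * ζ) ∧ IsOrd ρ α (jE ϖ ^ j) (dualGen ρ Θ α (jE ϖ ^ j) h x₀) ∧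
                  ¬ IsOrd ρ α (jE ϖ ^ j) (dualGen ρ Θ α (jE ϖ ^ j) h x₀ / jE ϖ) ∧ Valued.v (dualGen ρ Θ α (jE ϖ ^ j) h x₀) = Valued.v (jE ϖ) ^ b ∧
                  (∀ b', (∀ x ∈ Λ, Valued.v (h * Θ x * b' + ρ (h * Θ x * b')) ≤ 1) → (lam - jE ((u : Matrix (Fin 1) (Fin 1) E) 0 0)) * b' ∈ Λ)) →
                  (x₀' ≠ 0 ∧ (∀ x, x ∈ Λ ↔ ∃ ζ, IsOrd ρ α (jE ϖ ^ j) ζ ∧ x = x₀' * ζ) ∧ IsOrd ρ α (jE ϖ ^ j) (dualGen ρ Θ α (jE ϖ ^ j) h x₀') ∧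
                  ¬ IsOrd ρ α (jE ϖ ^ j) (dualGen ρ Θ α (jE ϖ ^ j) h x₀' / jE ϖ) ∧ Valued.v (dualGen ρ Θ α (jE ϖ ^ j) h x₀') = Valued.v (jE ϖ) ^ b ∧
                  (∀ b', (∀ x ∈ Λ, Valued.v (h * Θ x * b' + ρ (h * Θ x * b')) ≤ 1) → (lam - jE ((u : Matrix (Fin 1) (Fin 1) E) 0 0)) * b' ∈ Λ)) →
                  Valued.v (Vf x₀' - Vf x₀) ≤ Valued.v ϖ ^ n) →
                (∀ (Λ : AddSubgroup M) (x₀ : M),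
                  (x₀ ≠ 0 ∧ (∀ x, x ∈ Λ ↔ ∃ ζ, IsOrd ρ α (jE ϖ ^ j) ζ ∧ x = x₀ * ζ) ∧ IsOrd ρ α (jE ϖ ^ j) (dualGen ρ Θ α (jE ϖ ^ j) h x₀) ∧
                  ¬ IsOrd ρ α (jE ϖ ^ j) (dualGen ρ Θ α (jE ϖ ^ j) h x₀ / jE ϖ) ∧ Valued.v (dualGen ρ Θ α (jE ϖ ^ j) h x₀) = Valued.v (jE ϖ) ^ b ∧
                  (∀ b', (∀ x ∈ Λ, Valued.v (h * Θ x * b' + ρ (h * Θ x * b')) ≤ 1) → (lam - jE ((u : Matrix (Fin 1) (Fin 1) E) 0 0)) * b' ∈ Λ)) →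
                  ∃ Ve : E, jE Ve = Vf x₀ ∧ σ Ve = Ve ∧ Valued.v Ve ≤ 1) →
                (∀ (Λ : AddSubgroup M) (x₀ : M) (V₀ : E),
                  (x₀ ≠ 0 ∧ (∀ x, x ∈ Λ ↔ ∃ ζ, IsOrd ρ α (jE ϖ ^ j) ζ ∧ x = x₀ * ζ) ∧ IsOrd ρ α (jE ϖ ^ j) (dualGen ρ Θ α (jE ϖ ^ j) h x₀) ∧
                  ¬ IsOrd ρ α (jE ϖ ^ j) (dualGen ρ Θ α (jE ϖ ^ j) h x₀ / jE ϖ) ∧ Valued.v (dualGen ρ Θ α (jE ϖ ^ j) h x₀) = Valued.v (jE ϖ) ^ b ∧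
                  (∀ b', (∀ x ∈ Λ, Valued.v (h * Θ x * b' + ρ (h * Θ x * b')) ≤ 1) → (lam - jE ((u : Matrix (Fin 1) (Fin 1) E) 0 0)) * b' ∈ Λ)) →
                  V₀ ∈ Rd → Valued.v (Vf x₀ - jE V₀) ≤ Valued.v ϖ ^ n → LIT V₀) →
                (∀ y ∈ Rd.filter LIT, ∀ y' ∈ Rd.filter LIT,
                  {Λ : AddSubgroup M | ∃ x₀ : M,
                    (x₀ ≠ 0 ∧ (∀ x, x ∈ Λ ↔ ∃ ζ, IsOrd ρ α (jE ϖ ^ j) ζ ∧ x = x₀ * ζ) ∧ IsOrd ρ α (jE ϖ ^ j) (dualGen ρ Θ α (jE ϖ ^ j) h x₀) ∧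
                  ¬ IsOrd ρ α (jE ϖ ^ j) (dualGen ρ Θ α (jE ϖ ^ j) h x₀ / jE ϖ) ∧ Valued.v (dualGen ρ Θ α (jE ϖ ^ j) h x₀) = Valued.v (jE ϖ) ^ b ∧
                  (∀ b', (∀ x ∈ Λ, Valued.v (h * Θ x * b' + ρ (h * Θ x * b')) ≤ 1) → (lam - jE ((u : Matrix (Fin 1) (Fin 1) E) 0 0)) * b' ∈ Λ)) ∧
                    Valued.v (Vf x₀ - jE y) ≤ Valued.v ϖ ^ n}.ncard =
                  {Λ : AddSubgroup M | ∃ x₀ : M,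
                    (x₀ ≠ 0 ∧ (∀ x, x ∈ Λ ↔ ∃ ζ, IsOrd ρ α (jE ϖ ^ j) ζ ∧ x = x₀ * ζ) ∧ IsOrd ρ α (jE ϖ ^ j) (dualGen ρ Θ α (jE ϖ ^ j) h x₀) ∧
                  ¬ IsOrd ρ α (jE ϖ ^ j) (dualGen ρ Θ α (jE ϖ ^ j) h x₀ / jE ϖ) ∧ Valued.v (dualGen ρ Θ α (jE ϖ ^ j) h x₀) = Valued.v (jE ϖ) ^ b ∧
                  (∀ b', (∀ x ∈ Λ, Valued.v (h * Θ x * b' + ρ (h * Θ x * b')) ≤ 1) → (lam - jE ((u : Matrix (Fin 1) (Fin 1) E) 0 0)) * b' ∈ Λ)) ∧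
                    Valued.v (Vf x₀ - jE y') ≤ Valued.v ϖ ^ n}.ncard) →
              -- the affine letters of the value sphere `|α₁ + γ₁·V| = |ϖ|^{2ℓ}` and its sign token; (LH-3) `hrad`: the digit resolution reaches the conductor RELATIVE to the sphere
            ∀ (α₁ γ₁ : E) (ℓ : ℕ) (s₀ : ℤ), σ α₁ = α₁ → σ γ₁ = γ₁ → Valued.v γ₁ * Valued.v ϖ ^ n ≤ Valued.v ϖ ^ (2 * ℓ) * Valued.v ϖ ^ (2 * d - 1) →
            -- (LH-0)+(LH-1)+(LH-2) the reads at any presentation: `hNXd` (exact-level digit = value sphere), `hPcd` (ON the sphere, product class = affine sign)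
              (∀ (Λ : AddSubgroup M) (x₀ : M) (Ve : E),
                (x₀ ≠ 0 ∧ (∀ x, x ∈ Λ ↔ ∃ ζ, IsOrd ρ α (jE ϖ ^ j) ζ ∧ x = x₀ * ζ) ∧ IsOrd ρ α (jE ϖ ^ j) (dualGen ρ Θ α (jE ϖ ^ j) h x₀) ∧
                  ¬ IsOrd ρ α (jE ϖ ^ j) (dualGen ρ Θ α (jE ϖ ^ j) h x₀ / jE ϖ) ∧ Valued.v (dualGen ρ Θ α (jE ϖ ^ j) h x₀) = Valued.v (jE ϖ) ^ b ∧
                  (∀ b', (∀ x ∈ Λ, Valued.v (h * Θ x * b' + ρ (h * Θ x * b')) ≤ 1) → (lam - jE ((u : Matrix (Fin 1) (Fin 1) E) 0 0)) * b' ∈ Λ)) →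
                jE Ve = Vf x₀ →
                ((∃ (x₀ : M) (e₀ : E), x₀ ≠ 0 ∧ (∀ x, x ∈ Λ ↔ ∃ ζ, IsOrd ρ α (jE ϖ ^ j) ζ ∧ x = x₀ * ζ) ∧
                     IsOrd ρ α (jE ϖ ^ j) (dualGen ρ Θ α (jE ϖ ^ j) h x₀) ∧ ¬ IsOrd ρ α (jE ϖ ^ j) (dualGen ρ Θ α (jE ϖ ^ j) h x₀ / jE ϖ) ∧
                     Valued.v (dualGen ρ Θ α (jE ϖ ^ j) h x₀) = Valued.v (jE ϖ) ^ b ∧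
                     jE e₀ = (lam - jE ((u : Matrix (Fin 1) (Fin 1) E) 0 0)) / (jE ϖ ^ j * (α - ρ α) * Θ (dualGen ρ Θ α (jE ϖ ^ j) h x₀)) +
                       ρ ((lam - jE ((u : Matrix (Fin 1) (Fin 1) E) 0 0)) / (jE ϖ ^ j * (α - ρ α) * Θ (dualGen ρ Θ α (jE ϖ ^ j) h x₀))) ∧
                     Valued.v e₀ = Valued.v ϖ ^ (d % 2)) ↔
                  Valued.v (α₁ + γ₁ * Ve) = Valued.v ϖ ^ (2 * ℓ))) →
              (∀ (Λ : AddSubgroup M) (x₀ : M) (Ve : E),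
                (x₀ ≠ 0 ∧ (∀ x, x ∈ Λ ↔ ∃ ζ, IsOrd ρ α (jE ϖ ^ j) ζ ∧ x = x₀ * ζ) ∧ IsOrd ρ α (jE ϖ ^ j) (dualGen ρ Θ α (jE ϖ ^ j) h x₀) ∧
                  ¬ IsOrd ρ α (jE ϖ ^ j) (dualGen ρ Θ α (jE ϖ ^ j) h x₀ / jE ϖ) ∧ Valued.v (dualGen ρ Θ α (jE ϖ ^ j) h x₀) = Valued.v (jE ϖ) ^ b ∧
                  (∀ b', (∀ x ∈ Λ, Valued.v (h * Θ x * b' + ρ (h * Θ x * b')) ≤ 1) → (lam - jE ((u : Matrix (Fin 1) (Fin 1) E) 0 0)) * b' ∈ Λ)) →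
                jE Ve = Vf x₀ → Valued.v (α₁ + γ₁ * Ve) = Valued.v ϖ ^ (2 * ℓ) →
                ((∃ (x₀ : M) (r e₀ e' : E), x₀ ≠ 0 ∧ (∀ x, x ∈ Λ ↔ ∃ ζ, IsOrd ρ α (jE ϖ ^ j) ζ ∧ x = x₀ * ζ) ∧
                     IsOrd ρ α (jE ϖ ^ j) (dualGen ρ Θ α (jE ϖ ^ j) h x₀) ∧ ¬ IsOrd ρ α (jE ϖ ^ j) (dualGen ρ Θ α (jE ϖ ^ j) h x₀ / jE ϖ) ∧
                     Valued.v (dualGen ρ Θ α (jE ϖ ^ j) h x₀) = Valued.v (jE ϖ) ^ b ∧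
                     σ r = r ∧ Valued.v r = 1 ∧ jE r = glueUnit ρ Θ α (jE ϖ ^ j) h (jE ϖ) (jE hW) x₀ b ∧
                     jE e₀ = (lam - jE ((u : Matrix (Fin 1) (Fin 1) E) 0 0)) / (jE ϖ ^ j * (α - ρ α) * Θ (dualGen ρ Θ α (jE ϖ ^ j) h x₀)) +
                       ρ ((lam - jE ((u : Matrix (Fin 1) (Fin 1) E) 0 0)) / (jE ϖ ^ j * (α - ρ α) * Θ (dualGen ρ Θ α (jE ϖ ^ j) h x₀))) ∧
                     σ e' = e' ∧ Valued.v e' = 1 ∧ Valued.v (e₀ - e' * ((ϖ - σ ϖ) * ((ϖ * σ ϖ) ^ ((d - d % 2) / 2))⁻¹)) ≤ Valued.v ϖ ^ mstarOfRecord d ∧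
                     ∃ c : E, c * σ c = r * e') ↔
                  normSign σ (α₁ + γ₁ * Ve) = s₀)) →
            -- `hbase`: the digit balance on the literal part of the value sphere (★ `…ConeCellCountSocketDep` R0's bytes; payer ★ F1-type ∕ §2 `baseBalance_of_fullSphere`)
              (((Rd.filter LIT).filter fun V => Valued.v (α₁ + γ₁ * V) = Valued.v ϖ ^ (2 * ℓ)).filter fun V => normSign σ (α₁ + γ₁ * V) = s₀).card =
                (((Rd.filter LIT).filter fun V => Valued.v (α₁ + γ₁ * V) = Valued.v ϖ ^ (2 * ℓ)).filter fun V => ¬ normSign σ (α₁ + γ₁ * V) = s₀).card →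
              {Λ ∈ levelSetDep ρ Θ α (jE ϖ) h j b (lam - jE ((u : Matrix (Fin 1) (Fin 1) E) 0 0)) |
                  (∃ (x₀ : M) (e₀ : E), x₀ ≠ 0 ∧ (∀ x, x ∈ Λ ↔ ∃ ζ, IsOrd ρ α (jE ϖ ^ j) ζ ∧ x = x₀ * ζ) ∧
                     IsOrd ρ α (jE ϖ ^ j) (dualGen ρ Θ α (jE ϖ ^ j) h x₀) ∧ ¬ IsOrd ρ α (jE ϖ ^ j) (dualGen ρ Θ α (jE ϖ ^ j) h x₀ / jE ϖ) ∧
                     Valued.v (dualGen ρ Θ α (jE ϖ ^ j) h x₀) = Valued.v (jE ϖ) ^ b ∧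
                     jE e₀ = (lam - jE ((u : Matrix (Fin 1) (Fin 1) E) 0 0)) / (jE ϖ ^ j * (α - ρ α) * Θ (dualGen ρ Θ α (jE ϖ ^ j) h x₀)) +
                       ρ ((lam - jE ((u : Matrix (Fin 1) (Fin 1) E) 0 0)) / (jE ϖ ^ j * (α - ρ α) * Θ (dualGen ρ Θ α (jE ϖ ^ j) h x₀))) ∧
                     Valued.v e₀ = Valued.v ϖ ^ (d % 2)) ∧
                  (∃ (x₀ : M) (r e₀ e' : E), x₀ ≠ 0 ∧ (∀ x, x ∈ Λ ↔ ∃ ζ, IsOrd ρ α (jE ϖ ^ j) ζ ∧ x = x₀ * ζ) ∧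
                     IsOrd ρ α (jE ϖ ^ j) (dualGen ρ Θ α (jE ϖ ^ j) h x₀) ∧ ¬ IsOrd ρ α (jE ϖ ^ j) (dualGen ρ Θ α (jE ϖ ^ j) h x₀ / jE ϖ) ∧
                     Valued.v (dualGen ρ Θ α (jE ϖ ^ j) h x₀) = Valued.v (jE ϖ) ^ b ∧
                     σ r = r ∧ Valued.v r = 1 ∧ jE r = glueUnit ρ Θ α (jE ϖ ^ j) h (jE ϖ) (jE hW) x₀ b ∧
                     jE e₀ = (lam - jE ((u : Matrix (Fin 1) (Fin 1) E) 0 0)) / (jE ϖ ^ j * (α - ρ α) * Θ (dualGen ρ Θ α (jE ϖ ^ j) h x₀)) +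
                       ρ ((lam - jE ((u : Matrix (Fin 1) (Fin 1) E) 0 0)) / (jE ϖ ^ j * (α - ρ α) * Θ (dualGen ρ Θ α (jE ϖ ^ j) h x₀))) ∧
                     σ e' = e' ∧ Valued.v e' = 1 ∧ Valued.v (e₀ - e' * ((ϖ - σ ϖ) * ((ϖ * σ ϖ) ^ ((d - d % 2) / 2))⁻¹)) ≤ Valued.v ϖ ^ mstarOfRecord d ∧
                     ∃ c : E, c * σ c = r * e')}.ncard =
              {Λ ∈ levelSetDep ρ Θ α (jE ϖ) h j b (lam - jE ((u : Matrix (Fin 1) (Fin 1) E) 0 0)) |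
                  (∃ (x₀ : M) (e₀ : E), x₀ ≠ 0 ∧ (∀ x, x ∈ Λ ↔ ∃ ζ, IsOrd ρ α (jE ϖ ^ j) ζ ∧ x = x₀ * ζ) ∧
                     IsOrd ρ α (jE ϖ ^ j) (dualGen ρ Θ α (jE ϖ ^ j) h x₀) ∧ ¬ IsOrd ρ α (jE ϖ ^ j) (dualGen ρ Θ α (jE ϖ ^ j) h x₀ / jE ϖ) ∧
                     Valued.v (dualGen ρ Θ α (jE ϖ ^ j) h x₀) = Valued.v (jE ϖ) ^ b ∧
                     jE e₀ = (lam - jE ((u : Matrix (Fin 1) (Fin 1) E) 0 0)) / (jE ϖ ^ j * (α - ρ α) * Θ (dualGen ρ Θ α (jE ϖ ^ j) h x₀)) +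
                       ρ ((lam - jE ((u : Matrix (Fin 1) (Fin 1) E) 0 0)) / (jE ϖ ^ j * (α - ρ α) * Θ (dualGen ρ Θ α (jE ϖ ^ j) h x₀))) ∧
                     Valued.v e₀ = Valued.v ϖ ^ (d % 2)) ∧
                  ¬ (∃ (x₀ : M) (r e₀ e' : E), x₀ ≠ 0 ∧ (∀ x, x ∈ Λ ↔ ∃ ζ, IsOrd ρ α (jE ϖ ^ j) ζ ∧ x = x₀ * ζ) ∧
                       IsOrd ρ α (jE ϖ ^ j) (dualGen ρ Θ α (jE ϖ ^ j) h x₀) ∧ ¬ IsOrd ρ α (jE ϖ ^ j) (dualGen ρ Θ α (jE ϖ ^ j) h x₀ / jE ϖ) ∧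
                       Valued.v (dualGen ρ Θ α (jE ϖ ^ j) h x₀) = Valued.v (jE ϖ) ^ b ∧
                       σ r = r ∧ Valued.v r = 1 ∧ jE r = glueUnit ρ Θ α (jE ϖ ^ j) h (jE ϖ) (jE hW) x₀ b ∧
                       jE e₀ = (lam - jE ((u : Matrix (Fin 1) (Fin 1) E) 0 0)) / (jE ϖ ^ j * (α - ρ α) * Θ (dualGen ρ Θ α (jE ϖ ^ j) h x₀)) +
                         ρ ((lam - jE ((u : Matrix (Fin 1) (Fin 1) E) 0 0)) / (jE ϖ ^ j * (α - ρ α) * Θ (dualGen ρ Θ α (jE ϖ ^ j) h x₀))) ∧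
                       σ e' = e' ∧ Valued.v e' = 1 ∧ Valued.v (e₀ - e' * ((ϖ - σ ϖ) * ((ϖ * σ ϖ) ^ ((d - d % 2) / 2))⁻¹)) ≤ Valued.v ϖ ^ mstarOfRecord d ∧
                       ∃ c : E, c * σ c = r * e')}.ncard := by
  intro E M _ _ _ _ _ _ _ _ _ _ σ ϖ d tE _hD _hσσ _h2 jE ρ Θ α lam _hρρ _hvρ _hρj _hjv _hjfix _hΘj _hΘΘ _hΘρ _hvΘ _hα _hα1 _hint _hΘlam _hvlam _hbasis _hU _hτ
    _hσres _hres _hΘne _hDM _hjiso _hq _hjpow _hEval _hϖmax γ₂ u _hdet _htr _hirr _hlam2 _hρlam m jl _hm _hjl _hs _hp _hNm _hu1N _hlam1 _hu _hum H₂ hW _hH₂ _hH₂σ _hhW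
    _hhWσ P₁ _hA _hΓ φ h _hφs _hφi _hφo _hφγ _hform _hΘh _hh J R f _hfinF _hR _hJ _hfinLS _hf j b _hb1 _hjb _h2bm _hjl0 _hlow _hmix _hlamj
    Vf n Rd hRd1 hRd2 hRd3 LIT hgen hV hLit hF α₁ γ₁ ℓ s₀ hσα₁ hσγ₁ hrad hNXd hPcd hbase
  obtain ⟨-, -, hϖ, -, -, hd1, -⟩ := id _hD
  have hϖlt : Valued.v ϖ < 1 := by rw [hϖ, ← exp_zero, exp_lt_exp]; norm_num
  have hvϖ0 : Valued.v ϖ ≠ 0 := by rw [hϖ]; exact exp_ne_zero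
  -- the digit radii from `hrad`: `|γ₁|·|ϖ|^n ≤ |ϖ|^{2ℓ}·|ϖ|^{2d−1} < |ϖ|^{2ℓ}`
  have h2d1 : Valued.v ϖ ^ (2 * d - 1) < 1 := pow_lt_one₀ zero_le hϖlt (by omega)
  have hball : ∀ Ve V₀ : E, Valued.v (Ve - V₀) ≤ Valued.v ϖ ^ n →
      Valued.v (γ₁ * (Ve - V₀)) ≤ Valued.v ϖ ^ (2 * ℓ) * Valued.v ϖ ^ (2 * d - 1) ∧ Valued.v (γ₁ * (Ve - V₀)) < Valued.v ϖ ^ (2 * ℓ) := by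
    intro Ve V₀ hle
    have h1 : Valued.v (γ₁ * (Ve - V₀)) ≤ Valued.v ϖ ^ (2 * ℓ) * Valued.v ϖ ^ (2 * d - 1) := by rw [Valuation.map_mul]; exact (mul_le_mul' le_rfl hle).trans hrad
    refine ⟨h1, h1.trans_lt ?_⟩
    have hpos : (0 : ℤᵐ⁰) < Valued.v ϖ ^ (2 * ℓ) := zero_lt_iff.2 (pow_ne_zero _ hvϖ0)
    calc Valued.v ϖ ^ (2 * ℓ) * Valued.v ϖ ^ (2 * d - 1) < Valued.v ϖ ^ (2 * ℓ) * 1 := mul_lt_mul_of_pos_left h2d1 hpos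
      _ = Valued.v ϖ ^ (2 * ℓ) := mul_one _
  -- the bookkeeping `{Λ ∈ levelSetDep ∣ Q Λ} = {Λ ∣ (∃ x₀, GEN6 Λ x₀) ∧ Q Λ}`
  have hset : ∀ Q : AddSubgroup M → Prop,
      {Λ | Λ ∈ levelSetDep ρ Θ α (jE ϖ) h j b (lam - jE ((u : Matrix (Fin 1) (Fin 1) E) 0 0)) ∧ Q Λ} =
        {Λ : AddSubgroup M | (∃ x₀ : M,
          (x₀ ≠ 0 ∧ (∀ x, x ∈ Λ ↔ ∃ ζ, IsOrd ρ α (jE ϖ ^ j) ζ ∧ x = x₀ * ζ) ∧ IsOrd ρ α (jE ϖ ^ j) (dualGen ρ Θ α (jE ϖ ^ j) h x₀) ∧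
                  ¬ IsOrd ρ α (jE ϖ ^ j) (dualGen ρ Θ α (jE ϖ ^ j) h x₀ / jE ϖ) ∧ Valued.v (dualGen ρ Θ α (jE ϖ ^ j) h x₀) = Valued.v (jE ϖ) ^ b ∧
                  (∀ b', (∀ x ∈ Λ, Valued.v (h * Θ x * b' + ρ (h * Θ x * b')) ≤ 1) → (lam - jE ((u : Matrix (Fin 1) (Fin 1) E) 0 0)) * b' ∈ Λ))) ∧ Q Λ} := by
    intro Q; ext Λ; simp only [Set.mem_setOf_eq, mem_levelSetDep_iff, mem_levelSet_iff]; constructor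
    · rintro ⟨⟨⟨x₀, hx₀, hΛx, hyO, hyp, hylev⟩, hdep⟩, hQ⟩; exact ⟨⟨x₀, hx₀, hΛx, hyO, hyp, hylev, hdep⟩, hQ⟩
    · rintro ⟨⟨x₀, hx₀, hΛx, hyO, hyp, hylev, hdep⟩, hQ⟩; exact ⟨⟨⟨x₀, hx₀, hΛx, hyO, hyp, hylev⟩, hdep⟩, hQ⟩
  rw [hset, hset]
  -- `hbase` in §1's conjunction form
  have hbase' : ((Rd.filter LIT).filter fun V => Valued.v (α₁ + γ₁ * V) = Valued.v ϖ ^ (2 * ℓ) ∧ normSign σ (α₁ + γ₁ * V) = s₀).card =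
      ((Rd.filter LIT).filter fun V => Valued.v (α₁ + γ₁ * V) = Valued.v ϖ ^ (2 * ℓ) ∧ ¬ normSign σ (α₁ + γ₁ * V) = s₀).card := by
    rw [← Finset.filter_filter, ← Finset.filter_filter]; exact hbase
  -- §1
  refine ncard_sep_eq_ncard_sep_of_digit_reads (X := AddSubgroup M) _ Vf jE _hjiso (Valued.v ϖ ^ n) Rd hRd2 hRd3 LIT (fun V => Valued.v (α₁ + γ₁ * V) = Valued.v ϖ ^ (2 * ℓ)) (fun V => normSign σ (α₁ + γ₁ * V) = s₀)
    hgen hV hLit (fun Ve V₀ _ _ _ h4 => valueSphere_iff_of_near (hball Ve V₀ h4).2) (fun Ve V₀ hσVe _ hV₀R h4 hsph => ?_) hF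
    ((_hfinLS j b).subset fun Λ hΛ => ?_) _ _ hNXd hPcd hbase'
  · rw [normSign_affine_eq_of_near _hD hσα₁ hσγ₁ hσVe (hRd1 V₀ hV₀R).1 hsph (hball Ve V₀ h4).1]
  · obtain ⟨x₀, hx₀, hΛx, hyO, hyp, hylev, -⟩ := hΛ
    exact (mem_levelSet_iff ρ Θ α (jE ϖ) h j b Λ).2 ⟨x₀, hx₀, hΛx, hyO, hyp, hylev⟩

end Summit.HodgeConjecture.HodgeConjecture.Cruxes.H413.F0P3cDyRamMixBandProdBalanceOfFibresDiag

end
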